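import Mathlib
import Summits.ValiantsHypothesis.ValiantsHypothesis.Theorems.LacunarySymmetroidMatrixDescartesGramDualFamily
import Summits.ValiantsHypothesis.ValiantsHypothesis.Theorems.LacunarySymmetroidMatrixDescartesStubNegRoots
import Summits.ValiantsHypothesis.ValiantsHypothesis.Theorems.LacunarySymmetroidMatrixDescartesCensusFatSectors

/-!
# `MatrixDescartes` (stmt-ValiantsHypothesis-18050) — Gram duality, part 12: THE ORTHOGONAL-LETTERS SECTOR in the
# crux's currency — `Σ_l X^{d_l} S_l` with one non-degenerate letter `S_{l₀}` and the other letters pairwise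
# `S_{l₀}⁻¹`-orthogonal has `Z₊ ≤ (K−1)·m`, hence the crux inequality at every fat format

HONEST FRAMING.  Cell `pub-symmetroid`, seat `val-sym-mdr-p2` (gen 19); helper file `--supports` the crux
`Theses.LacunarySymmetroid.MatrixDescartes` (OPEN), NO closure claim; companion of `…GramDualFamily` (splitting law
for families + one-letter bound).  A SECTOR law for pencils exactly as typed in the crux (`Fin K` letters, real
symmetric `m × m`, arbitrary exponents); nothing here bears on the crux in its window, `stub_twoSided`,
`DoorA26` / `DoorA34`, registers, or `VP ≠ VNP`.

THE SECTOR.  Real symmetric letters `S_0, …, S_{K−1}`, a distinguished letter `S_{l₀}` with `det S_{l₀} ≠ 0` (any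
signature), and PAIRWISE `S_{l₀}⁻¹`-ORTHOGONALITY of the other letters: `S_k S_{l₀}⁻¹ S_l = 0` for `k ≠ l` both
`≠ l₀` (the ranges of `S_k` and `S_l` are orthogonal for the indefinite metric `S_{l₀}⁻¹`).  Exponents arbitrary
(both sides of `d_{l₀}`, ties allowed), letters of any signs and ranks, any size.

* `padded_letter_eq` — a letter diagonalised as `S = P diag(λ) Pᵀ` is, at exponent `d`, the signed column system of
  the columns of `P` PADDED with zero columns where `λᵢ = 0` (signs `λᵢ` resp. `1`): all letters then share the
  column type `Fin m` and all signs are non-zero.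
* `padded_gram_eq_zero` — `S S₀⁻¹ T = 0` with `PᵀP = 1`, `QᵀQ = 1` ⇒ the padded columns of `S` and `T` are
  `S₀⁻¹`-orthogonal (`pᵀS₀⁻¹q = (λμ)⁻¹ pᵀ S S₀⁻¹ T q` for eigenvectors).
* **`card_posRoots_orthogonalLetters_pencil_le` (THE LAW).**  On the sector, `Z₊(Σ_l X^{d_l} S_l) ≤ (K−1)·m`
  (spectral theorem per letter, family splitting + one-letter bound of `…GramDualFamily`).
* **`orthogonalLetters_mdr` (THE CRUX INEQUALITY ON THE SECTOR, every fat format).**  For all `c, q` there is `K₀`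
  with: `K ≥ K₀`, `m ≤ 2^{(⌊log₂K⌋+c)^c}`, any exponents, any sector pencil ⇒ `Z^q ≤ 2^{K⌊log₂K⌋}` for the number
  `Z` of distinct real zeros (the reflected pencil `S_l ↦ (−1)^{d_l}S_l` stays in the sector: `reflect_orthogonal`,
  `isUnit_det_reflect`; `stub_negRoots`; `Census.fatFormat_absorb`).
The tree's K-dependent two-sided laws need commuting letters AND pivot (`stub_commutingTwoSided`), one letter per
side (V-law), hyperbolicity, or sign/regime hypotheses; this one needs only a metric orthogonality of ranges.

[folklore] (spectral theorem + Sylvester + block determinants).  Axioms `propext`, `Classical.choice`, `Quot.sound`.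
-/

-- layout Summits/ValiantsHypothesis/ValiantsHypothesis forces the duplicated namespace component
set_option linter.dupNamespace false

namespace Summit.ValiantsHypothesis.ValiantsHypothesis.Theorems.LacunarySymmetroidMatrixDescartes

open Polynomial Matrix Finset
open scoped BigOperators

namespace GramDual

variable {m : ℕ}

/-- the signed column part (file-local notation, as in `…GramDualSigned`) -/
local notation3 (prettyPrint := false) "𝕊[" U ", " σ ", " δ "]" =>
  ((U : Matrix _ _ ℝ).map Polynomial.C
      * Matrix.diagonal (fun j => Polynomial.C ((σ : _ → ℝ) j) * (Polynomial.X : Polynomial ℝ) ^ (δ j : ℕ))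
      * ((U : Matrix _ _ ℝ).map Polynomial.C)ᵀ)

/-- padded column matrix of a diagonalisation datum `(P, λ)`: column `i` of `P` if `λᵢ ≠ 0`, else `0`
(file-local notation) -/
local notation3 (prettyPrint := false) "Upad[" P ", " lam "]" =>
  (Matrix.of fun (a i : Fin _) => if (lam : Fin _ → ℝ) i ≠ 0 then (P : Matrix _ _ ℝ) a i else (0 : ℝ))

/-- padded signs: `λᵢ` if `λᵢ ≠ 0`, else `1` (file-local notation) -/
local notation3 (prettyPrint := false) "σpad[" lam "]" =>
  (fun i : Fin _ => if (lam : Fin _ → ℝ) i ≠ 0 then (lam : Fin _ → ℝ) i else (1 : ℝ))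

/-! ## §1  Padded signed column form of one diagonalised letter -/

/-- Entry formula of a diagonalised matrix: `(P diag(λ) Pᵀ) a b = Σ_i P_{a i} λ_i P_{b i}`. [folklore] -/
theorem diag_apply_eq_sum (P : Matrix (Fin m) (Fin m) ℝ) (lam : Fin m → ℝ) (a b : Fin m) :
    (P * Matrix.diagonal lam * Pᵀ) a b = ∑ i, P a i * lam i * P b i := by
  rw [Matrix.mul_apply]
  refine Finset.sum_congr rfl fun i _ => ?_
  rw [Matrix.mul_diagonal, Matrix.transpose_apply]

/-- The padded signs are non-zero. -/
theorem sigmaPad_ne_zero (lam : Fin m → ℝ) (i : Fin m) : (σpad[lam]) i ≠ 0 := by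
  simp only
  split_ifs with hi
  · exact hi
  · exact one_ne_zero

/-- **Padded column form of a diagonalised letter**: `S = P diag(λ) Pᵀ` ⇒
`X^d • S = Upad · diag(σpad · X^d) · Upadᵀ`. [folklore] -/
theorem padded_letter_eq {S P : Matrix (Fin m) (Fin m) ℝ} {lam : Fin m → ℝ} (hfac : S = P * Matrix.diagonal lam * Pᵀ)
    (d : ℕ) :
    ((Polynomial.X : Polynomial ℝ) ^ d) • S.map Polynomial.C = 𝕊[Upad[P, lam], σpad[lam], (fun _ : Fin m => d)] := by
  refine Matrix.ext fun a b => ?_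
  have hR : (𝕊[Upad[P, lam], σpad[lam], (fun _ : Fin m => d)]) a b
      = ∑ i, Polynomial.C ((Upad[P, lam]) a i) * (Polynomial.C ((σpad[lam]) i) * (Polynomial.X : Polynomial ℝ) ^ d)
          * Polynomial.C ((Upad[P, lam]) b i) := by
    rw [Matrix.mul_apply]
    refine Finset.sum_congr rfl fun i _ => ?_
    rw [Matrix.mul_diagonal, Matrix.transpose_apply, Matrix.map_apply, Matrix.map_apply]
  rw [hR, Matrix.smul_apply, Matrix.map_apply, hfac, diag_apply_eq_sum P lam a b, map_sum, smul_eq_mul,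
    Finset.mul_sum]
  refine Finset.sum_congr rfl fun i _ => ?_
  simp only [Matrix.of_apply]
  by_cases hi : lam i ≠ 0
  · rw [if_pos hi, if_pos hi, if_pos hi, map_mul, map_mul]
    ring
  · have hi' : lam i = 0 := not_not.1 hi
    rw [if_neg hi, if_neg hi, if_neg hi, hi']
    simp only [mul_zero, zero_mul, map_zero]

/-! ## §2  Orthogonality transfer -/

/-- Column `i` of an orthogonal `P` with `S = P diag(λ) Pᵀ` is an eigenvector: `S pᵢ = λᵢ pᵢ`. [folklore] -/
theorem mulVec_col_of_fac {S P : Matrix (Fin m) (Fin m) ℝ} {lam : Fin m → ℝ} (hfac : S = P * Matrix.diagonal lam * Pᵀ)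
    (hP : Pᵀ * P = 1) (i : Fin m) :
    S *ᵥ (fun a => P a i) = lam i • (fun a => P a i) := by
  have hSP : S * P = P * Matrix.diagonal lam := by
    rw [hfac, Matrix.mul_assoc, hP, Matrix.mul_one]
  funext a
  have h := congrFun (congrFun hSP a) i
  rw [Matrix.mul_apply, Matrix.mul_diagonal] at h
  simp only [Matrix.mulVec, dotProduct, Pi.smul_apply, smul_eq_mul]
  rw [h, mul_comm]

/-- `pᵀ M q` through `S p = λ p`, `T q = μ q`: `p ⬝ᵥ M q = (λμ)⁻¹ · p ⬝ᵥ (Sᵀ M T) q`. [folklore] -/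
theorem dot_mulVec_of_eig {S T M : Matrix (Fin m) (Fin m) ℝ} {p q : Fin m → ℝ} {lam mu : ℝ} (hlam : lam ≠ 0)
    (hmu : mu ≠ 0) (hp : S *ᵥ p = lam • p) (hq : T *ᵥ q = mu • q) :
    p ⬝ᵥ (M *ᵥ q) = (lam * mu)⁻¹ * (p ⬝ᵥ ((Sᵀ * M * T) *ᵥ q)) := by
  have h1 : (Sᵀ * M * T) *ᵥ q = mu • (Sᵀ *ᵥ (M *ᵥ q)) := by
    rw [← Matrix.mulVec_mulVec, ← Matrix.mulVec_mulVec, hq, Matrix.mulVec_smul, Matrix.mulVec_smul]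
  have h2 : p ⬝ᵥ (Sᵀ *ᵥ (M *ᵥ q)) = lam * (p ⬝ᵥ (M *ᵥ q)) := by
    rw [Matrix.dotProduct_mulVec, Matrix.vecMul_transpose, hp, smul_dotProduct, smul_eq_mul]
  rw [h1, dotProduct_smul, h2, smul_eq_mul]
  field_simp

/-- **Orthogonality transfer**: `S S₀⁻¹ T = 0` (`S = P diag(λ)Pᵀ`, `T = Q diag(μ)Qᵀ`, `PᵀP = QᵀQ = 1`) ⇒ the
padded columns are `S₀⁻¹`-orthogonal: `Upad[P,λ]ᵀ S₀⁻¹ Upad[Q,μ] = 0`. [folklore] -/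
theorem padded_gram_eq_zero {S T P Q : Matrix (Fin m) (Fin m) ℝ} {lam mu : Fin m → ℝ}
    (hS : S = P * Matrix.diagonal lam * Pᵀ) (hP : Pᵀ * P = 1) (hT : T = Q * Matrix.diagonal mu * Qᵀ)
    (hQ : Qᵀ * Q = 1) (S₀ : Matrix (Fin m) (Fin m) ℝ) (h0 : S * S₀⁻¹ * T = 0) :
    (Upad[P, lam])ᵀ * S₀⁻¹ * Upad[Q, mu] = 0 := by
  have hSt : Sᵀ = S := by
    rw [hS, Matrix.transpose_mul, Matrix.transpose_mul, Matrix.transpose_transpose, Matrix.diagonal_transpose,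
      Matrix.mul_assoc]
  refine Matrix.ext fun i j => ?_
  have hentry : ((Upad[P, lam])ᵀ * S₀⁻¹ * Upad[Q, mu]) i j
      = (fun a => (Upad[P, lam]) a i) ⬝ᵥ (S₀⁻¹ *ᵥ fun b => (Upad[Q, mu]) b j) := by
    simp only [Matrix.mul_apply, Matrix.transpose_apply, dotProduct, Matrix.mulVec, Finset.sum_mul]
    rw [Finset.sum_comm]
    refine Finset.sum_congr rfl fun a _ => ?_
    rw [Finset.mul_sum]
    refine Finset.sum_congr rfl fun b _ => ?_
    ring
  have hcolP : (fun a => (Upad[P, lam]) a i) = if lam i ≠ 0 then (fun a => P a i) else 0 := by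
    funext a
    simp only [Matrix.of_apply]
    split_ifs <;> rfl
  have hcolQ : (fun b => (Upad[Q, mu]) b j) = if mu j ≠ 0 then (fun b => Q b j) else 0 := by
    funext b
    simp only [Matrix.of_apply]
    split_ifs <;> rfl
  rw [hentry, hcolP, hcolQ, Matrix.zero_apply]
  by_cases hi : lam i ≠ 0
  · by_cases hj : mu j ≠ 0
    · rw [if_pos hi, if_pos hj,
        dot_mulVec_of_eig (M := S₀⁻¹) hi hj (mulVec_col_of_fac hS hP i) (mulVec_col_of_fac hT hQ j), hSt, h0,
        Matrix.zero_mulVec, dotProduct_zero, mul_zero]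
    · rw [if_neg hj, Matrix.mulVec_zero, dotProduct_zero]
  · rw [if_neg hi, zero_dotProduct]

/-! ## §3  The law in the crux's currency -/

variable {K : ℕ}

/-- `card {l // l ≠ l₀} = K − 1`. [folklore] -/
theorem card_ne_eq (l₀ : Fin K) : Fintype.card {l : Fin K // l ≠ l₀} = K - 1 := by
  classical
  rw [Fintype.card_subtype, Finset.filter_ne' Finset.univ l₀, Finset.card_erase_of_mem (Finset.mem_univ _),
    Finset.card_univ, Fintype.card_fin]

/-- Spectral datum of a real symmetric matrix: `S = P diag(λ) Pᵀ` with `PᵀP = 1`. [folklore] -/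
theorem exists_diag_datum {S : Matrix (Fin m) (Fin m) ℝ} (hS : S.IsSymm) :
    ∃ (P : Matrix (Fin m) (Fin m) ℝ) (lam : Fin m → ℝ), Pᵀ * P = 1 ∧ S = P * Matrix.diagonal lam * Pᵀ := by
  have hH : S.IsHermitian := Matrix.isHermitian_iff_isSymm.2 hS
  refine ⟨(hH.eigenvectorUnitary : Matrix (Fin m) (Fin m) ℝ), hH.eigenvalues, ?_, ?_⟩
  · have h := Unitary.coe_star_mul_self hH.eigenvectorUnitary
    rwa [Matrix.star_eq_conjTranspose, Matrix.conjTranspose_eq_transpose_of_trivial] at h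
  · have h : S = (hH.eigenvectorUnitary : Matrix (Fin m) (Fin m) ℝ) * Matrix.diagonal hH.eigenvalues
        * star (hH.eigenvectorUnitary : Matrix (Fin m) (Fin m) ℝ) := by
      simpa [Unitary.conjStarAlgAut_apply] using hH.spectral_theorem
    rwa [Matrix.star_eq_conjTranspose, Matrix.conjTranspose_eq_transpose_of_trivial] at h

/-- **THE ORTHOGONAL-LETTERS LAW (crux currency).**  Real symmetric letters, `det S_{l₀} ≠ 0`, and
`S_k S_{l₀}⁻¹ S_l = 0` for all `k ≠ l` different from `l₀`: `Z₊(Σ_l X^{d_l} S_l) ≤ (K − 1)·m`, for every size `m`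
and all exponents. [folklore] -/
theorem card_posRoots_orthogonalLetters_pencil_le (d : Fin K → ℕ) (S : Fin K → Matrix (Fin m) (Fin m) ℝ)
    (hS : ∀ l, (S l).IsSymm) (l₀ : Fin K) (hS₀ : IsUnit (S l₀).det)
    (horth : ∀ k l, k ≠ l₀ → l ≠ l₀ → k ≠ l → S k * (S l₀)⁻¹ * S l = 0) :
    ((Matrix.det (∑ l, ((Polynomial.X : Polynomial ℝ) ^ d l) • (S l).map Polynomial.C)).roots.toFinset.filter
        (fun t => 0 < t)).card ≤ (K - 1) * m := by
  classical
  choose P lam hP hfac using fun l => exists_diag_datum (hS l)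
  -- split off the base letter and pad the others
  have hsplit : (∑ l, ((Polynomial.X : Polynomial ℝ) ^ d l) • (S l).map Polynomial.C)
      = ((Polynomial.X : Polynomial ℝ) ^ d l₀) • (S l₀).map Polynomial.C
        + ∑ l : {l : Fin K // l ≠ l₀}, 𝕊[Upad[P l.1, lam l.1], σpad[lam l.1], (fun _ : Fin m => d l.1)] := by
    rw [← Finset.add_sum_erase _ _ (Finset.mem_univ l₀)]
    congr 1
    rw [Finset.sum_subtype (Finset.univ.erase l₀) (p := fun l => l ≠ l₀)
      (fun l => by simp only [Finset.mem_erase, Finset.mem_univ, and_true])]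
    exact Finset.sum_congr rfl fun l _ => padded_letter_eq (hfac l.1) (d l.1)
  rw [hsplit]
  have h := card_posRoots_orthogonalLetters_le (S l₀) hS₀
    (fun l : {l : Fin K // l ≠ l₀} => Upad[P l.1, lam l.1]) (fun l => σpad[lam l.1])
    (fun l i => sigmaPad_ne_zero (lam l.1) i) (d l₀) (fun l => d l.1)
    (fun k l hkl => padded_gram_eq_zero (hfac k.1) (hP k.1) (hfac l.1) (hP l.1) (S l₀)
      (horth k.1 l.1 k.2 l.2 fun h => hkl (Subtype.ext h)))
  have hcard : Fintype.card {l : Fin K // l ≠ l₀} * Fintype.card (Fin m) = (K - 1) * m := by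
    rw [card_ne_eq, Fintype.card_fin]
  exact h.trans hcard.le

/-! ## §4  The crux inequality on the sector -/

/-- The reflected letters `(−1)^{n} S` are symmetric. [folklore] -/
theorem isSymm_reflect {S : Matrix (Fin m) (Fin m) ℝ} (hS : S.IsSymm) (n : ℕ) : (((-1 : ℝ) ^ n) • S).IsSymm :=
  hS.smul _

/-- The reflected base letter is non-degenerate. [folklore] -/
theorem isUnit_det_reflect {S : Matrix (Fin m) (Fin m) ℝ} (hS : IsUnit S.det) (n : ℕ) :
    IsUnit (((-1 : ℝ) ^ n) • S).det := by
  rw [Matrix.det_smul, isUnit_iff_ne_zero]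
  exact mul_ne_zero (pow_ne_zero _ (pow_ne_zero _ (by norm_num))) hS.ne_zero

/-- Inverse of the reflected base: `((−1)^n S)⁻¹ = (−1)^n S⁻¹`. [folklore] -/
theorem inv_reflect {S : Matrix (Fin m) (Fin m) ℝ} (hS : IsUnit S.det) (n : ℕ) :
    (((-1 : ℝ) ^ n) • S)⁻¹ = ((-1 : ℝ) ^ n) • S⁻¹ := by
  refine Matrix.inv_eq_right_inv ?_
  rw [Matrix.smul_mul, Matrix.mul_smul, smul_smul, ← mul_pow, neg_mul_neg, one_mul, one_pow, one_smul,
    Matrix.mul_nonsing_inv _ hS]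

/-- **The sector is closed under reflection** `S_l ↦ (−1)^{d_l} S_l`. [folklore] -/
theorem reflect_orthogonal (d : Fin K → ℕ) (S : Fin K → Matrix (Fin m) (Fin m) ℝ) (l₀ : Fin K)
    (hS₀ : IsUnit (S l₀).det) (horth : ∀ k l, k ≠ l₀ → l ≠ l₀ → k ≠ l → S k * (S l₀)⁻¹ * S l = 0) :
    ∀ k l, k ≠ l₀ → l ≠ l₀ → k ≠ l →
      (((-1 : ℝ) ^ d k) • S k) * ((((-1 : ℝ) ^ d l₀) • S l₀))⁻¹ * (((-1 : ℝ) ^ d l) • S l) = 0 := by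
  intro k l hk hl hkl
  rw [inv_reflect hS₀]
  simp only [Matrix.smul_mul, Matrix.mul_smul, smul_smul]
  rw [horth k l hk hl hkl, smul_zero]

/-- **All real zeros on the sector**: `Z ≤ 2(K−1)m + 1`. [folklore] -/
theorem card_roots_orthogonalLetters_le (d : Fin K → ℕ) (S : Fin K → Matrix (Fin m) (Fin m) ℝ)
    (hS : ∀ l, (S l).IsSymm) (l₀ : Fin K) (hS₀ : IsUnit (S l₀).det)
    (horth : ∀ k l, k ≠ l₀ → l ≠ l₀ → k ≠ l → S k * (S l₀)⁻¹ * S l = 0) :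
    (Matrix.det (∑ l, ((Polynomial.X : Polynomial ℝ) ^ d l) • (S l).map Polynomial.C)).roots.toFinset.card
      ≤ (K - 1) * m + (K - 1) * m + 1 := by
  have h1 := card_posRoots_orthogonalLetters_pencil_le d S hS l₀ hS₀ horth
  have h2 := card_posRoots_orthogonalLetters_pencil_le d (fun l => ((-1 : ℝ) ^ d l) • S l)
    (fun l => isSymm_reflect (hS l) (d l)) l₀ (isUnit_det_reflect hS₀ (d l₀)) (reflect_orthogonal d S l₀ hS₀ horth)
  have h3 := stub_negRoots K m d S
  omega

/-- **THE CRUX INEQUALITY ON THE ORTHOGONAL-LETTERS SECTOR, every fat format.**  For all `c, q` there is `K₀` such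
that for `K ≥ K₀`, `m ≤ 2^{(⌊log₂K⌋+c)^c}`, all exponents, all real symmetric letters with a non-degenerate `S_{l₀}` and
the other letters pairwise `S_{l₀}⁻¹`-orthogonal: `Z^q ≤ 2^{K⌊log₂K⌋}` for the number `Z` of distinct real zeros of
`det(Σ_l X^{d_l} S_l)` — the quantifier shape of `MatrixDescartes` on this format family. [folklore] -/
theorem orthogonalLetters_mdr (c q : ℕ) : ∃ K₀ : ℕ, ∀ K m : ℕ, K₀ ≤ K → m ≤ 2 ^ ((Nat.log 2 K + c) ^ c) →
    ∀ (d : Fin K → ℕ) (S : Fin K → Matrix (Fin m) (Fin m) ℝ), (∀ l, (S l).IsSymm) →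
    ∀ l₀ : Fin K, IsUnit (S l₀).det →
    (∀ k l, k ≠ l₀ → l ≠ l₀ → k ≠ l → S k * (S l₀)⁻¹ * S l = 0) →
    (Matrix.det (∑ l, ((Polynomial.X : Polynomial ℝ) ^ d l) • (S l).map Polynomial.C)).roots.toFinset.card ^ q
      ≤ 2 ^ (K * Nat.log 2 K) := by
  obtain ⟨K₀, hK₀⟩ := Census.fatFormat_absorb 1 c q
  refine ⟨K₀, fun K m hK hm d S hS l₀ hS₀ horth => hK₀ K m _ hK hm ?_⟩
  have hZ := card_roots_orthogonalLetters_le d S hS l₀ hS₀ horth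
  have h1 : (K - 1) * m ≤ K * m := Nat.mul_le_mul_right _ (Nat.sub_le _ _)
  have h4 : (K - 1) * m + (K - 1) * m + 1 ≤ 2 ^ 1 * (m + 1) * (K + 1) := by nlinarith
  exact hZ.trans h4

end GramDual

end Summit.ValiantsHypothesis.ValiantsHypothesis.Theorems.LacunarySymmetroidMatrixDescartes
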